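import Summits.QuantumAdvantage.QuantumAdvantage.Theorems.CharDialPartyDialI7

/-!
# PartyDial (decomp-qadv lens-5 g35), part I8 — §8i: ALL VARIABLES SUFFICE — `FullSumIndep3At` (S = every coordinate of a cube of dimension ≥ m₀; the literal corollary shape of Green–Roy–Straubing 2005 Thm 1.1 / Bourgain 2005 Thm 1.1 (i) with (m, q) := (3, p)) and ★ `subsetSumIndep3At_of_full : FullSumIndep3At p D ε m₀ → SubsetSumIndep3At p D ε m₀` (condition on Sᶜ, reindex by `restr`/`extd`, `extd_restr`, `restr_extd`, `card_ones_restr`, `card_restr_count`); converse `fullSumIndep3At_of_subsetSum`; `FSI3W w k`, `ssi3W_of_fsi3W`, `frobHardOdd_iff_manyDeep` (doubly-primed form)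

See part A (`CharDialPartyDialA`) for the node header; memo `NODE-g35.md` (g35 folder of decomp-qadv-lens-5).
-/

set_option autoImplicit false
set_option linter.dupNamespace false

namespace Summit.QuantumAdvantage.QuantumAdvantage.Theorems.PartyDial

open Finset
open Summit.QuantumAdvantage.AdviceFreeQNC0

/-! ### §8i  The ALL-VARIABLES form `FullSumIndep3At` (S = every coordinate — the literal corollary shape of
Green–Roy–Straubing 2005, Thm 1.1 with `(m, q) := (3, p)`) already gives the subset form: condition on `Sᶜ`
(`indep_of_conditionings`) and reindex `S ≃ Fin #S` (`restr` / `extd`) -/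

section FullSum

open Literature.Computability.MetaComplexity

variable {m : ℕ}

/-- **the all-variables analytic input** `FullSumIndep3At p D ε m₀`: on every cube `{0,1}^m` with `m ≥ m₀`, a Boolean
`f` of `𝔽_p`-degree `≤ D` is `ε`-independent of the number of ones OF THE WHOLE INPUT mod 3.  [= `SubsetSumIndep3At`
at `S = univ`; the shape in print: Green–Roy–Straubing, C. R. Math. 341 (2005), Thm 1.1 / Bourgain, C. R. Math. 340
(2005), Thm 1.1 (i), with `(m, q) := (3, p)`, after the standard character-sum step; NOT in the tree, NOT proved here.] -/
def FullSumIndep3At (p : ℕ) [Fact p.Prime] (D : ℕ) (ε : ℝ) (m₀ : ℕ) : Prop :=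
  ∀ (m : ℕ), m₀ ≤ m → ∀ (f : (Fin m → Bool) → Bool), HasDegF p f D → ∀ (a r : ℕ),
    ((univ.filter fun t : Fin m → Bool => f t = true).card : ℝ) / 3 - ε * (2 : ℝ) ^ m ≤
      ((univ.filter fun t : Fin m → Bool => f t = true ∧
        (a + (univ.filter fun i : Fin m => t i = true).card) % 3 = r % 3).card : ℝ)

/-- the subset form specialises to the all-variables form (`S := univ`). -/
theorem fullSumIndep3At_of_subsetSum {p : ℕ} [Fact p.Prime] {D : ℕ} {ε : ℝ} {m₀ : ℕ}
    (h : SubsetSumIndep3At p D ε m₀) : FullSumIndep3At p D ε m₀ := by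
  intro m hm f hf a r
  have hS : m₀ ≤ (univ : Finset (Fin m)).card := by rwa [Finset.card_univ, Fintype.card_fin]
  exact h m f hf univ hS a r

/-- restriction of a point of `{0,1}^m` to the coordinates `S`, read through `e : ↥S ≃ Fin s`. -/
def restr (S : Finset (Fin m)) {s : ℕ} (e : ↥S ≃ Fin s) (t : Fin m → Bool) : Fin s → Bool :=
  fun j => t (e.symm j).1

/-- extension of a point of the small cube `{0,1}^s` to `{0,1}^m` by `b` off `S`. -/
def extd (S : Finset (Fin m)) {s : ℕ} (e : ↥S ≃ Fin s) (b : Fin m → Bool) (v : Fin s → Bool) : Fin m → Bool :=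
  fun i => if h : i ∈ S then v (e ⟨i, h⟩) else b i

/-- extend ∘ restrict = condition on `Sᶜ`. -/
theorem extd_restr (S : Finset (Fin m)) {s : ℕ} (e : ↥S ≃ Fin s) (b t : Fin m → Bool) :
    extd S e b (restr S e t) = ovr Sᶜ b t := by
  funext i
  by_cases hi : i ∈ S
  · have hc : i ∉ Sᶜ := fun h => (mem_compl.1 h) hi
    simp only [extd, hi, dif_pos, restr, Equiv.symm_apply_apply, ovr, hc, if_false]
  · have hc : i ∈ Sᶜ := mem_compl.2 hi
    simp only [extd, hi, dif_neg, not_false_eq_true, ovr, hc, if_true]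

/-- restrict ∘ extend = identity. -/
theorem restr_extd (S : Finset (Fin m)) {s : ℕ} (e : ↥S ≃ Fin s) (b : Fin m → Bool) (v : Fin s → Bool) :
    restr S e (extd S e b v) = v := by
  funext j
  simp only [restr, extd, (e.symm j).2, dif_pos, Subtype.coe_eta, Equiv.apply_symm_apply]

/-- the number of ones in `S` is the number of ones of the restriction. -/
theorem card_ones_restr (S : Finset (Fin m)) {s : ℕ} (e : ↥S ≃ Fin s) (t : Fin m → Bool) :
    (univ.filter fun j : Fin s => restr S e t j = true).card = (S.filter fun i => t i = true).card := by
  symm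
  refine Finset.card_bij (fun i hi => e ⟨i, (mem_filter.1 hi).1⟩) (fun i hi => ?_) (fun i hi i' hi' h => ?_)
    (fun j hj => ?_)
  · rw [mem_filter]
    refine ⟨mem_univ _, ?_⟩
    simp only [restr, Equiv.symm_apply_apply]
    exact (mem_filter.1 hi).2
  · exact congrArg Subtype.val (e.injective h)
  · refine ⟨(e.symm j).1, mem_filter.2 ⟨(e.symm j).2, ?_⟩, ?_⟩
    · have := (mem_filter.1 hj).2
      simpa [restr] using this
    · simp only [Subtype.coe_eta, Equiv.apply_symm_apply]

/-- counting through the restriction map: every point of the small cube has exactly `2^{#Sᶜ}` preimages. -/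
theorem card_restr_count (S : Finset (Fin m)) {s : ℕ} (e : ↥S ≃ Fin s) (Q : (Fin s → Bool) → Prop)
    [DecidablePred Q] :
    (univ.filter fun t : Fin m → Bool => Q (restr S e t)).card =
      2 ^ Sᶜ.card * (univ.filter fun v : Fin s → Bool => Q v).card := by
  classical
  have hmap : ∀ t ∈ (univ.filter fun t : Fin m → Bool => Q (restr S e t)),
      restr S e t ∈ (univ.filter fun v : Fin s → Bool => Q v) :=
    fun t ht => mem_filter.2 ⟨mem_univ _, (mem_filter.1 ht).2⟩
  rw [Finset.card_eq_sum_card_fiberwise hmap]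
  have hfib : ∀ v ∈ (univ.filter fun v : Fin s → Bool => Q v),
      ((univ.filter fun t : Fin m → Bool => Q (restr S e t)).filter fun t => restr S e t = v).card =
        2 ^ Sᶜ.card := by
    intro v hv
    rw [← card_agree_off Sᶜ (extd S e (fun _ => false) v)]
    congr 1
    ext t
    simp only [mem_filter, mem_univ, true_and]
    constructor
    · rintro ⟨_, htv⟩ i hi
      have hiS : i ∈ S := by
        by_contra h'
        exact hi (mem_compl.2 h')
      rw [← htv]
      simp only [extd, hiS, dif_pos, restr, Equiv.symm_apply_apply]
    · intro ht
      have htv : restr S e t = v := by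
        funext j
        have hj : (e.symm j).1 ∉ Sᶜ := fun h' => (mem_compl.1 h') (e.symm j).2
        have := ht _ hj
        rw [restr, this]
        simp only [extd, (e.symm j).2, dif_pos, Subtype.coe_eta, Equiv.apply_symm_apply]
      exact ⟨by rw [htv]; exact (mem_filter.1 hv).2, htv⟩
  rw [Finset.sum_congr rfl hfib, Finset.sum_const, smul_eq_mul, mul_comm]

/-- ★ **all variables suffice**: the all-variables fact gives the subset-sum fact (same `D`, `ε`, `m₀`), hence
(§8h) the weighted one and every dial of §8–§8g. -/
theorem subsetSumIndep3At_of_full {p : ℕ} [Fact p.Prime] {D : ℕ} {ε : ℝ} {m₀ : ℕ}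
    (h : FullSumIndep3At p D ε m₀) : SubsetSumIndep3At p D ε m₀ := by
  intro m f hf S hS a r
  have e : ↥S ≃ Fin S.card := Fintype.equivFinOfCardEq (Fintype.card_coe S)
  refine indep_of_conditionings Sᶜ f (fun u => (a + (S.filter fun i => u i = true).card) % 3 = r % 3) fun b => ?_
  have hdeg : HasDegF p (fun v : Fin S.card → Bool => f (extd S e b v)) D := by
    unfold HasDegF at hf ⊢
    refine Smolensky.comp_subst_mem_lowDeg (F := ZMod p) (fun v : Fin S.card → Bool => extd S e b v)
      (fun i => ?_) hf
    by_cases hi : i ∈ S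
    · exact Or.inr ⟨e ⟨i, hi⟩, fun v => by simp [extd, hi]⟩
    · exact Or.inl ⟨b i, fun v => by simp [extd, hi]⟩
  have hfull := h S.card hS _ hdeg a r
  have hcond : ∀ t : Fin m → Bool, (S.filter fun i => ovr Sᶜ b t i = true) = S.filter fun i => t i = true := by
    intro t
    refine Finset.filter_congr fun i hi => ?_
    have hc : i ∉ Sᶜ := fun h' => (mem_compl.1 h') hi
    simp [ovr, hc]
  have e1 : (univ.filter fun t : Fin m → Bool => f (ovr Sᶜ b t) = true) =
      univ.filter fun t : Fin m → Bool => f (extd S e b (restr S e t)) = true :=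
    Finset.filter_congr fun t _ => by rw [extd_restr]
  have e2 : (univ.filter fun t : Fin m → Bool => f (ovr Sᶜ b t) = true ∧
        (a + (S.filter fun i => ovr Sᶜ b t i = true).card) % 3 = r % 3) =
      univ.filter fun t : Fin m → Bool => f (extd S e b (restr S e t)) = true ∧
        (a + (univ.filter fun j : Fin S.card => restr S e t j = true).card) % 3 = r % 3 :=
    Finset.filter_congr fun t _ => by rw [extd_restr, hcond t, card_ones_restr]
  have c1 : (univ.filter fun t : Fin m → Bool => f (extd S e b (restr S e t)) = true).card =
      2 ^ Sᶜ.card * (univ.filter fun v : Fin S.card → Bool => f (extd S e b v) = true).card :=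
    card_restr_count S e (fun v => f (extd S e b v) = true)
  have c2 : (univ.filter fun t : Fin m → Bool => f (extd S e b (restr S e t)) = true ∧
        (a + (univ.filter fun j : Fin S.card => restr S e t j = true).card) % 3 = r % 3).card =
      2 ^ Sᶜ.card * (univ.filter fun v : Fin S.card → Bool => f (extd S e b v) = true ∧
        (a + (univ.filter fun j : Fin S.card => v j = true).card) % 3 = r % 3).card :=
    card_restr_count S e (fun v => f (extd S e b v) = true ∧
      (a + (univ.filter fun j : Fin S.card => v j = true).card) % 3 = r % 3)
  rw [e1, e2, c1, c2]
  have h2 : (0 : ℝ) < (2 : ℝ) ^ Sᶜ.card := by positivity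
  have hpow : (2 : ℝ) ^ Sᶜ.card * (2 : ℝ) ^ S.card = (2 : ℝ) ^ m := by
    rw [← pow_add, Finset.card_compl_add_card, Fintype.card_fin]
  have key := mul_le_mul_of_nonneg_left hfull h2.le
  have lhs : (2 : ℝ) ^ Sᶜ.card * (((univ.filter fun v : Fin S.card → Bool => f (extd S e b v) = true).card : ℝ) / 3 -
      ε * (2 : ℝ) ^ S.card) = ((2 ^ Sᶜ.card * (univ.filter fun v : Fin S.card → Bool =>
        f (extd S e b v) = true).card : ℕ) : ℝ) / 3 - ε * (2 : ℝ) ^ m := by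
    rw [← hpow]; push_cast; ring
  rw [lhs] at key
  refine key.trans (le_of_eq ?_)
  push_cast
  ring

/-- the all-variables fact at level `(w, k)`. -/
def FSI3W (w k : ℕ) : Prop :=
  ∀ (p : ℕ) [Fact p.Prime], 5 ≤ p → ∃ m₀ : ℕ,
    FullSumIndep3At p (w * 3 ^ k * (p - 1)) (1 / (12 * 2 ^ (w * 3 ^ k))) m₀

/-- all-variables ⟹ subset ⟹ weighted: `FSI3W w k → SSI3W w k` (and on to `LDI3W w k`, §8h). -/
theorem ssi3W_of_fsi3W {w k : ℕ} (h : FSI3W w k) : SSI3W w k := by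
  intro p _ hp
  obtain ⟨m₀, hm₀⟩ := h p hp
  exact ⟨m₀, subsetSumIndep3At_of_full hm₀⟩

/-- ★ **The dial on T, all-variables hypothesis**: GIVEN `FSI3W w k`, `FrobHardOdd ⟺ ManyDeepFrobOdd w k`. -/
theorem frobHardOdd_iff_manyDeep'' (w k : ℕ) (hF : FSI3W w k) :
    Summit.QuantumAdvantage.QuantumAdvantage.Theses.CharDial.FrobHardOdd ↔ ManyDeepFrobOdd w k :=
  frobHardOdd_iff_manyDeep' w k (ssi3W_of_fsi3W hF)

end FullSum

end Summit.QuantumAdvantage.QuantumAdvantage.Theorems.PartyDial
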